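import Summits.AnomalousDissipation.AnomalousDissipation.Theorems.ScalarZerothLawKinematicPeriod
import Summits.AnomalousDissipation.AnomalousDissipation.Theorems.ScalarZerothLawKinematicAverages
import Summits.AnomalousDissipation.AnomalousDissipation.Theorems.ScalarZerothLawKinematicBudget
import Literature.Analysis.FluidPDE.PassiveScalarDiagEnergyContinuity
import HarnessLib

/-!
# Scalar zeroth law over a prescribed carrier — the energy conjuncts along a solution

Cell `ad-ideate`, planner ad-ideate-p1 ROUND-10 §B3, Step 1 completed: for an `L²`-continuous
global weak solution `w` of `∂ₜθ + b·∇θ = κ ∑ᵢ aᵢ ∂ᵢ∂ᵢθ + S` (bounded drift `b` equal to the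
Hess-Childs–Rowan field `W` on the active units `(nL, nL+1)`, contraction factor `q` with
`2Lq ≤ 1` on mean-zero data — hypothesis `hHCR` —, steady smooth mean-zero source, `κ > 0`,
`aᵢ > 0`, mean-zero `L²` datum), with `N(t) = ‖w(t)‖_{L²}`, `σ = ‖S‖_{L²}`, `a_n = N(nL)`,
`R = Lσ/(1-q)`:

* `periodStart_succ_le` — `a_{n+1} ≤ q a_n + Lσ`; `periodStart_le` — `a_n ≤ qⁿ a₀ + R`;
* `sqrt_integral_sq_le_geom` — `N(t) ≤ q^{⌊t/L⌋} a₀ + R + Lσ` for every `t ≥ 0`;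
* `sqrt_integral_sq_le_uniform` — **(E∞)** `N(t) ≤ ‖θ₀‖ + 3Lσ` for every `t ≥ 0` (`L ≥ 12`);
* `longTimeAvgSup_integral_sq_le` — **(E)** `⟨‖w‖²⟩⁺ ≤ 9 L² σ²`.

Supports stmt-AnomalousDissipation-0448 (prescribed-carrier rung; no statement about Navier–Stokes).
-/

noncomputable section

-- `Summit.<Summit>.<Problem>` is the tree's mandated summit-side namespace (CONVENTIONS §2); for this
-- single-conjunct summit the two coincide, so the duplicate is deliberate.
set_option linter.dupNamespace false

namespace Summit.AnomalousDissipation.AnomalousDissipation.Theorems.ScalarZerothLawKinematic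

open MeasureTheory Set Filter Topology
open scoped NNReal ENNReal InnerProductSpace
open Literature.Analysis Literature.Analysis.FluidPDE Literature.Analysis.FunctionSpaces
open Literature.Analysis.FluidPDE.Torus Literature.Analysis.FunctionSpaces.Torus

section Energy

variable {d : Type*} [Fintype d] [DecidableEq d]
  {a : d → ℝ} {κ L A q : ℝ} {b W : ℝ → UnitAddTorus d → EuclideanSpace ℝ d}
  {S θ₀ : UnitAddTorus d → ℝ} {w : ℝ → UnitAddTorus d → ℝ}

/-- **The period recursion** `‖w((n+1)L)‖ ≤ q ‖w(nL)‖ + L ‖S‖`: contraction on the active unit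
(`sqrt_integral_sq_activeEnd_le`) followed by growth on the rest of the period (`L ≥ 1`). -/
theorem periodStart_succ_le (hw : IsWeakScalarTransportDiagForced a κ b (fun _ => S) θ₀ w)
    (hwc : IsL2ContinuousOn (Ici 0) w) (hκ : 0 < κ) (ha : ∀ i, 0 < a i) (hθ₀ : MemLp θ₀ 2 volume)
    (hmean : ∫ x, θ₀ x = 0) (hSmean : ∫ x, S x = 0) (hS : IsSmooth S)
    (hbA : ∀ (t : ℝ) (x : UnitAddTorus d), ‖b t x‖ ≤ A) (hq : 0 ≤ q)
    (hHCR : ∀ η₀ : UnitAddTorus d → ℝ, MemLp η₀ 2 volume → ∫ x, η₀ x = 0 →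
      ∀ η : ℝ → UnitAddTorus d → ℝ, IsWeakScalarTransportDiagOn 1 a κ W η₀ η →
        IsL2ContinuousOn (Icc 0 1) η → Torus.scalarL2Sq (η 1) ≤ q ^ 2 * Torus.scalarL2Sq η₀)
    (hbW : ∀ (n : ℕ), ∀ t ∈ Ioo (0 : ℝ) 1, b ((n : ℝ) * L + t) = W t) (hL : 1 ≤ L) (n : ℕ) :
    Real.sqrt (∫ x, w (((n + 1 : ℕ) : ℝ) * L) x ^ 2) ≤
      q * Real.sqrt (∫ x, w ((n : ℝ) * L) x ^ 2) + L * Real.sqrt (∫ x, S x ^ 2) := by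
  have h1 := sqrt_integral_sq_activeEnd_le hw hwc hκ ha hmean hSmean hS hbA hq hHCR (hbW n) (by linarith)
  have h2 := sqrt_integral_sq_le_add_mul hw hwc hκ ha hθ₀ hbA (hS.memLp 2)
    (show 0 ≤ (n : ℝ) * L + 1 by positivity) (show (n : ℝ) * L + 1 ≤ ((n + 1 : ℕ) : ℝ) * L by push_cast; nlinarith)
  have e : ((n + 1 : ℕ) : ℝ) * L - ((n : ℝ) * L + 1) = L - 1 := by push_cast; ring
  rw [e] at h2
  have hσ : 0 ≤ Real.sqrt (∫ x, S x ^ 2) := Real.sqrt_nonneg _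
  nlinarith

/-- **Geometric decay of the period-start energies**: `‖w(nL)‖ ≤ qⁿ ‖w(0)‖ + Lσ/(1-q)` (`q < 1`). -/
theorem periodStart_le (hw : IsWeakScalarTransportDiagForced a κ b (fun _ => S) θ₀ w)
    (hwc : IsL2ContinuousOn (Ici 0) w) (hκ : 0 < κ) (ha : ∀ i, 0 < a i) (hθ₀ : MemLp θ₀ 2 volume)
    (hmean : ∫ x, θ₀ x = 0) (hSmean : ∫ x, S x = 0) (hS : IsSmooth S)
    (hbA : ∀ (t : ℝ) (x : UnitAddTorus d), ‖b t x‖ ≤ A) (hq : 0 ≤ q) (hq1 : q < 1)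
    (hHCR : ∀ η₀ : UnitAddTorus d → ℝ, MemLp η₀ 2 volume → ∫ x, η₀ x = 0 →
      ∀ η : ℝ → UnitAddTorus d → ℝ, IsWeakScalarTransportDiagOn 1 a κ W η₀ η →
        IsL2ContinuousOn (Icc 0 1) η → Torus.scalarL2Sq (η 1) ≤ q ^ 2 * Torus.scalarL2Sq η₀)
    (hbW : ∀ (n : ℕ), ∀ t ∈ Ioo (0 : ℝ) 1, b ((n : ℝ) * L + t) = W t) (hL : 1 ≤ L) (n : ℕ) :
    Real.sqrt (∫ x, w ((n : ℝ) * L) x ^ 2) ≤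
      q ^ n * Real.sqrt (∫ x, w 0 x ^ 2) + L * Real.sqrt (∫ x, S x ^ 2) / (1 - q) := by
  have key := geom_recursion_le (a := fun n : ℕ => Real.sqrt (∫ x, w ((n : ℝ) * L) x ^ 2)) hq hq1
    (by positivity : 0 ≤ L * Real.sqrt (∫ x, S x ^ 2))
    (fun n => periodStart_succ_le hw hwc hκ ha hθ₀ hmean hSmean hS hbA hq hHCR hbW hL n) n
  simpa using key

/-- **The energy at every time**: `‖w(t)‖ ≤ q^{⌊t/L⌋} ‖w(0)‖ + Lσ/(1-q) + Lσ` for `t ≥ 0`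
(growth from the start `⌊t/L⌋ L` of the current period). -/
theorem sqrt_integral_sq_le_geom (hw : IsWeakScalarTransportDiagForced a κ b (fun _ => S) θ₀ w)
    (hwc : IsL2ContinuousOn (Ici 0) w) (hκ : 0 < κ) (ha : ∀ i, 0 < a i) (hθ₀ : MemLp θ₀ 2 volume)
    (hmean : ∫ x, θ₀ x = 0) (hSmean : ∫ x, S x = 0) (hS : IsSmooth S)
    (hbA : ∀ (t : ℝ) (x : UnitAddTorus d), ‖b t x‖ ≤ A) (hq : 0 ≤ q) (hq1 : q < 1)
    (hHCR : ∀ η₀ : UnitAddTorus d → ℝ, MemLp η₀ 2 volume → ∫ x, η₀ x = 0 →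
      ∀ η : ℝ → UnitAddTorus d → ℝ, IsWeakScalarTransportDiagOn 1 a κ W η₀ η →
        IsL2ContinuousOn (Icc 0 1) η → Torus.scalarL2Sq (η 1) ≤ q ^ 2 * Torus.scalarL2Sq η₀)
    (hbW : ∀ (n : ℕ), ∀ t ∈ Ioo (0 : ℝ) 1, b ((n : ℝ) * L + t) = W t) (hL : 1 ≤ L)
    {t : ℝ} (ht : 0 ≤ t) :
    Real.sqrt (∫ x, w t x ^ 2) ≤
      q ^ ⌊t / L⌋₊ * Real.sqrt (∫ x, w 0 x ^ 2) + L * Real.sqrt (∫ x, S x ^ 2) / (1 - q) +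
        L * Real.sqrt (∫ x, S x ^ 2) := by
  have hL0 : 0 < L := by linarith
  set n : ℕ := ⌊t / L⌋₊ with hn
  have hnt : (n : ℝ) * L ≤ t := by
    have := Nat.floor_le (div_nonneg ht hL0.le)
    rw [← hn] at this
    rwa [le_div_iff₀ hL0] at this
  have htn : t - (n : ℝ) * L ≤ L := by
    have := Nat.lt_floor_add_one (t / L)
    rw [← hn, div_lt_iff₀ hL0] at this
    linarith
  have h1 := periodStart_le hw hwc hκ ha hθ₀ hmean hSmean hS hbA hq hq1 hHCR hbW hL n
  have h2 := sqrt_integral_sq_le_add_mul hw hwc hκ ha hθ₀ hbA (hS.memLp 2) (by positivity) hnt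
  have hσ : 0 ≤ Real.sqrt (∫ x, S x ^ 2) := Real.sqrt_nonneg _
  have : (t - (n : ℝ) * L) * Real.sqrt (∫ x, S x ^ 2) ≤ L * Real.sqrt (∫ x, S x ^ 2) :=
    mul_le_mul_of_nonneg_right htn hσ
  linarith

/-- **(E∞) The energy is bounded uniformly in time, `κ` and the period index**: for `L ≥ 12` and
`2Lq ≤ 1`, `‖w(t)‖_{L²} ≤ ‖θ₀‖_{L²} + 3L‖S‖_{L²}` for every `t ≥ 0`. -/
theorem sqrt_integral_sq_le_uniform (hw : IsWeakScalarTransportDiagForced a κ b (fun _ => S) θ₀ w)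
    (hwc : IsL2ContinuousOn (Ici 0) w) (hκ : 0 < κ) (ha : ∀ i, 0 < a i) (hθ₀ : MemLp θ₀ 2 volume)
    (hmean : ∫ x, θ₀ x = 0) (hSmean : ∫ x, S x = 0) (hS : IsSmooth S)
    (hbA : ∀ (t : ℝ) (x : UnitAddTorus d), ‖b t x‖ ≤ A) (hq : 0 ≤ q) (hqL : q * (2 * L) ≤ 1)
    (hHCR : ∀ η₀ : UnitAddTorus d → ℝ, MemLp η₀ 2 volume → ∫ x, η₀ x = 0 →
      ∀ η : ℝ → UnitAddTorus d → ℝ, IsWeakScalarTransportDiagOn 1 a κ W η₀ η →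
        IsL2ContinuousOn (Icc 0 1) η → Torus.scalarL2Sq (η 1) ≤ q ^ 2 * Torus.scalarL2Sq η₀)
    (hbW : ∀ (n : ℕ), ∀ t ∈ Ioo (0 : ℝ) 1, b ((n : ℝ) * L + t) = W t) (hL : 12 ≤ L) (hw0 : w 0 = θ₀)
    {t : ℝ} (ht : 0 ≤ t) :
    Real.sqrt (∫ x, w t x ^ 2) ≤ Real.sqrt (∫ x, θ₀ x ^ 2) + 3 * L * Real.sqrt (∫ x, S x ^ 2) := by
  have hq24 : q ≤ 1 / 24 := by
    have : q * 24 ≤ q * (2 * L) := mul_le_mul_of_nonneg_left (by linarith) hq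
    linarith
  have hq1 : q < 1 := by linarith
  have h := sqrt_integral_sq_le_geom hw hwc hκ ha hθ₀ hmean hSmean hS hbA hq hq1 hHCR hbW (by linarith) ht
  rw [hw0] at h
  set σ : ℝ := Real.sqrt (∫ x, S x ^ 2) with hσdef
  have hσ : 0 ≤ σ := Real.sqrt_nonneg _
  set R : ℝ := L * σ / (1 - q) with hRdef
  have h1q : 0 < 1 - q := by linarith
  have hR : R * (1 - q) = L * σ := by rw [hRdef, div_mul_cancel₀ _ h1q.ne']
  have hR0 : 0 ≤ R := by rw [hRdef]; exact div_nonneg (by positivity) h1q.le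
  obtain ⟨-, hRL, -⟩ := asymptotic_energy_le hq24 hR0 hσ (by linarith : (0 : ℝ) ≤ L) hR
  have hpow : q ^ ⌊t / L⌋₊ * Real.sqrt (∫ x, θ₀ x ^ 2) ≤ Real.sqrt (∫ x, θ₀ x ^ 2) := by
    have : q ^ ⌊t / L⌋₊ ≤ 1 := pow_le_one₀ hq hq1.le
    have h0 : 0 ≤ Real.sqrt (∫ x, θ₀ x ^ 2) := Real.sqrt_nonneg _
    nlinarith
  linarith

/-- **(E) The long-time-mean energy is bounded**: `limsup_T T⁻¹ ∫₀ᵀ ‖w(t)‖²_{L²} dt ≤ 9 L² ‖S‖²_{L²}`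
(the period-start energies decay geometrically to `≤ Lσ/(1-q)`, the energy inside a period exceeds
its start value by at most `Lσ`, `(Lσ/(1-q) + Lσ)² ≤ 9L²σ²` for `q ≤ 1/24`; late pointwise bounds
pass to the running means, `eventually_timeMean_le_add_of_le`). -/
theorem longTimeAvgSup_integral_sq_le (hw : IsWeakScalarTransportDiagForced a κ b (fun _ => S) θ₀ w)
    (hwc : IsL2ContinuousOn (Ici 0) w) (hκ : 0 < κ) (ha : ∀ i, 0 < a i) (hθ₀ : MemLp θ₀ 2 volume)
    (hmean : ∫ x, θ₀ x = 0) (hSmean : ∫ x, S x = 0) (hS : IsSmooth S)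
    (hbA : ∀ (t : ℝ) (x : UnitAddTorus d), ‖b t x‖ ≤ A) (hq : 0 ≤ q) (hqL : q * (2 * L) ≤ 1)
    (hHCR : ∀ η₀ : UnitAddTorus d → ℝ, MemLp η₀ 2 volume → ∫ x, η₀ x = 0 →
      ∀ η : ℝ → UnitAddTorus d → ℝ, IsWeakScalarTransportDiagOn 1 a κ W η₀ η →
        IsL2ContinuousOn (Icc 0 1) η → Torus.scalarL2Sq (η 1) ≤ q ^ 2 * Torus.scalarL2Sq η₀)
    (hbW : ∀ (n : ℕ), ∀ t ∈ Ioo (0 : ℝ) 1, b ((n : ℝ) * L + t) = W t) (hL : 12 ≤ L) :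
    longTimeAvgSup (fun t => Torus.scalarL2Sq (w t)) ≤ 9 * L ^ 2 * Torus.scalarL2Sq S := by
  have hL0 : 0 < L := by linarith
  have hq24 : q ≤ 1 / 24 := by
    have : q * 24 ≤ q * (2 * L) := mul_le_mul_of_nonneg_left (by linarith) hq
    linarith
  have hq1 : q < 1 := by linarith
  set σ : ℝ := Real.sqrt (∫ x, S x ^ 2) with hσdef
  have hσ : 0 ≤ σ := Real.sqrt_nonneg _
  have hσ2 : σ ^ 2 = Torus.scalarL2Sq S := Real.sq_sqrt (integral_nonneg fun x => sq_nonneg _)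
  set R : ℝ := L * σ / (1 - q) with hRdef
  have h1q : 0 < 1 - q := by linarith
  have hR : R * (1 - q) = L * σ := by rw [hRdef, div_mul_cancel₀ _ h1q.ne']
  have hR0 : 0 ≤ R := by rw [hRdef]; exact div_nonneg (by positivity) h1q.le
  obtain ⟨-, -, hsq⟩ := asymptotic_energy_le hq24 hR0 hσ hL0.le hR
  set X : ℝ := R + L * σ with hXdef
  have hX0 : 0 ≤ X := by positivity
  set a0 : ℝ := Real.sqrt (∫ x, w 0 x ^ 2) with ha0def
  have ha00 : 0 ≤ a0 := Real.sqrt_nonneg _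
  -- the pointwise bound `N(t) ≤ q^{⌊t/L⌋} a0 + X`
  have hN : ∀ t, 0 ≤ t → Real.sqrt (∫ x, w t x ^ 2) ≤ q ^ ⌊t / L⌋₊ * a0 + X := by
    intro t ht
    have := sqrt_integral_sq_le_geom hw hwc hκ ha hθ₀ hmean hSmean hS hbA hq hq1 hHCR hbW (by linarith) ht
    simpa only [hXdef, hRdef, add_assoc] using this
  -- interval integrability of the energy (continuous on `[0,∞)`)
  have hgi : ∀ T : ℝ, 0 ≤ T → IntervalIntegrable (fun t => Torus.scalarL2Sq (w t)) volume 0 T := by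
    intro T hT
    exact ((hwc.continuousOn_integral_sq).mono Icc_subset_Ici_self).intervalIntegrable_of_Icc hT
  -- lower bound of the running means
  have hlow : ∀ᶠ T in atTop, (0 : ℝ) ≤ timeMean (fun t => Torus.scalarL2Sq (w t)) T := by
    filter_upwards [eventually_gt_atTop (0 : ℝ)] with T hT
    exact mul_nonneg (inv_nonneg.2 hT.le)
      (intervalIntegral.integral_nonneg hT.le fun t _ => Torus.scalarL2Sq_nonneg _)
  suffices hmain : longTimeAvgSup (fun t => Torus.scalarL2Sq (w t)) ≤ X ^ 2 by
    calc longTimeAvgSup (fun t => Torus.scalarL2Sq (w t)) ≤ X ^ 2 := hmain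
      _ ≤ 9 * L ^ 2 * σ ^ 2 := hsq
      _ = 9 * L ^ 2 * Torus.scalarL2Sq S := by rw [hσ2]
  refine longTimeAvgSup_le_of_forall_pos_eventually_le (c := X ^ 2) hlow fun ε hε => ?_
  -- choose `η` with `(η + X)² ≤ X² + ε/2` and `n₀` with `q^{n₀} a0 ≤ η`
  obtain ⟨η, hη0, hη⟩ : ∃ η : ℝ, 0 < η ∧ (η + X) ^ 2 ≤ X ^ 2 + ε / 2 := by
    refine ⟨min 1 (ε / 2 / (2 * X + 1)), lt_min one_pos (by positivity), ?_⟩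
    set η := min 1 (ε / 2 / (2 * X + 1)) with hηdef
    have h1 : η ≤ 1 := min_le_left _ _
    have h2 : η ≤ ε / 2 / (2 * X + 1) := min_le_right _ _
    have h3 : η * (2 * X + 1) ≤ ε / 2 := by rwa [le_div_iff₀ (by positivity)] at h2
    have h0 : 0 ≤ η := le_min zero_le_one (by positivity)
    nlinarith
  obtain ⟨n₀, hn₀⟩ : ∃ n₀ : ℕ, q ^ n₀ * a0 ≤ η := by
    obtain ⟨n₀, hn₀⟩ := exists_pow_lt_of_lt_one (show 0 < η / (a0 + 1) by positivity) hq1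
    refine ⟨n₀, ?_⟩
    have : q ^ n₀ * (a0 + 1) ≤ η := by
      have := (lt_div_iff₀ (by positivity : 0 < a0 + 1)).1 hn₀
      exact this.le
    nlinarith [pow_nonneg hq n₀]
  have hlate : ∀ t : ℝ, (n₀ : ℝ) * L ≤ t → Torus.scalarL2Sq (w t) ≤ X ^ 2 + ε / 2 := by
    intro t ht
    have ht0 : 0 ≤ t := le_trans (by positivity) ht
    have hfloor : n₀ ≤ ⌊t / L⌋₊ := Nat.le_floor (by rwa [le_div_iff₀ hL0])
    have hpow : q ^ ⌊t / L⌋₊ * a0 ≤ η := by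
      have : q ^ ⌊t / L⌋₊ ≤ q ^ n₀ := pow_le_pow_of_le_one hq hq1.le hfloor
      nlinarith
    have hNt := hN t ht0
    have hNt' : Real.sqrt (∫ x, w t x ^ 2) ≤ η + X := by linarith
    have hsq' : Torus.scalarL2Sq (w t) = Real.sqrt (∫ x, w t x ^ 2) ^ 2 :=
      (Real.sq_sqrt (integral_nonneg fun x => sq_nonneg _)).symm
    rw [hsq']
    calc Real.sqrt (∫ x, w t x ^ 2) ^ 2 ≤ (η + X) ^ 2 :=
          pow_le_pow_left₀ (Real.sqrt_nonneg _) hNt' 2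
      _ ≤ X ^ 2 + ε / 2 := hη
  have hev := eventually_timeMean_le_add_of_le (by positivity : 0 ≤ (n₀ : ℝ) * L) hgi hlate
    (half_pos hε)
  filter_upwards [hev] with T hT
  linarith

end Energy

end Summit.AnomalousDissipation.AnomalousDissipation.Theorems.ScalarZerothLawKinematic

end
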